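import Summits.QuantumAdvantage.QuantumAdvantage.Theorems.CubicForrelationNearExactIsExactTwelveTypeOPairParity

/-!
# Crux `CubicForrelation.NearExactIsExact` (stmt-QuantumAdvantage-14043) — n = 12, (O,O) pairs: RESIDUES of the weight `#E₁` of the cubic support
  in the two branches of the parity dichotomy

Certificate seat `b2b-cforr-cert` (gen 30).  HONEST FRAMING: kernel-checked finite-slice lemmas (standard axioms); bookkeeping for the wild (O,O) world
(PLAN-N12-WINDOW-OO.md §5).  Nothing excluded by itself; NO value of `θ₁₂`; NOT summit progress.

In the setting of `topw_master` (both sides type O, `κ₁` cubic, decompositions with wild functions `v₁, v₂`), `E₁ = {κ₁}`: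
* `topq_card_typeO_branch`: if every `v̂₁(y)/4` is odd (the "κ₁ type O" branch of `topp_parity_dichotomy`) then `#E₁ ≡ 8 (mod 16)`; consequently
  (`kt3_weights_twelve`: all cubic weights `< 1024` are `≡ 0 (mod 32)`) `#E₁ > 1024` — the support weight lies in the Kasami–Tokura–Azumi range with
  residue `8 mod 16` (`topq_typeO_branch_gt`).
* `topq_card_level_branch`: if `8 ∣ v̂₁(y)` for every `y` then `16 ∣ #E₁`.
[`topw_card`: `#E₁ = 1024 + 16χ′(1 − 4[κ₂ c₁]) + 2(−1)^{b₁}v̂₁(c₁) + 128(−1)^{b₁}v₂(c₁)` with `χ′(1 − 4[κ₂ c₁])` odd.]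

References: T. Kasami, N. Tokura (1970) (in the tree as `kt3_weights_twelve`); T. Kasami, N. Tokura, S. Azumi, Inform. Control 30 (1976) 380–395 (the
range `[2d, 2.5d)`, not used).  Axioms: the standard three.
-/

set_option linter.dupNamespace false -- D-0017: single-problem summit ⇒ `QuantumAdvantage.QuantumAdvantage` by design

noncomputable section

namespace Summit.QuantumAdvantage.QuantumAdvantage.Theorems.CubicForrelation.NearExactIsExact

open Finset
open Literature.Computability.QuantumComplexity
open Literature.Computability.QuantumComplexity.BuzetChailloux (bxor zeroVec twist_zeroVec_right)
open Literature.Computability.QuantumComplexity.DerivativeWalsh (W)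

/-- **Type-O branch: `#E₁ ≡ 8 (mod 16)`.**  Setting of `topw_master`; if `v̂₁(c₁) = 4k` with `k` odd then `#E₁ % 16 = 8`. [this work] -/
theorem topq_card_typeO_branch (F₁ F₂ : (Fin (6 + 6) → Bool) → Bool) (u₁ u₂ v₁ v₂ : (Fin (6 + 6) → Bool) → ℤ)
    (hu₁ : ∀ x, W (fun y => signOf (F₁ y)) x = (2 : ℝ) ^ 4 * (u₁ x : ℝ))
    (hu₂ : ∀ y, W (fun x => signOf (F₂ x)) y = (2 : ℝ) ^ 4 * (u₂ y : ℝ))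
    (κ₁ κ₂ : (Fin (6 + 6) → Bool) → Bool) (b₁ b₂ : Bool) (c₁ c₂ : Fin (6 + 6) → Bool)
    (h₁ : ∀ x, (((u₁ x - 4 * sZ (F₂ x) : ℤ)) : ℝ) = signOf b₁ * twist c₁ x * (1 - 4 * (if κ₁ x = true then 1 else 0)) + 8 * (v₁ x : ℝ))
    (h₂ : ∀ y, (((u₂ y - 4 * sZ (F₁ y) : ℤ)) : ℝ) = signOf b₂ * twist c₂ y * (1 - 4 * (if κ₂ y = true then 1 else 0)) + 8 * (v₂ y : ℝ))
    (k : ℤ) (hk : Odd k) (hkv : ∑ x, (v₁ x : ℝ) * twist x c₁ = 4 * (k : ℝ)) :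
    #(univ.filter fun x => κ₁ x = true) % 16 = 8 := by
  classical
  have hc := topw_card F₁ F₂ u₁ u₂ v₁ v₂ hu₁ hu₂ κ₁ κ₂ b₁ b₂ c₁ c₂ h₁ h₂
  rw [hkv] at hc
  obtain ⟨T, hT1, hT⟩ : ∃ T : ℤ, (T = 1 ∨ T = -1) ∧ twist c₂ c₁ = (T : ℝ) := by
    rcases Literature.Computability.QuantumComplexity.Simon.twist_eq_one_or c₂ c₁ with h | h
    · exact ⟨1, Or.inl rfl, by rw [h]; norm_num⟩
    · exact ⟨-1, Or.inr rfl, by rw [h]; norm_num⟩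
  set K : ℤ := if κ₂ c₁ = true then 1 else 0 with hKdef
  have hKR : (if κ₂ c₁ = true then (1 : ℝ) else 0) = (K : ℝ) := by simp only [hKdef]; split_ifs <;> simp
  rw [hT, hKR, ← tp_sZ_cast b₁, ← tp_sZ_cast b₂] at hc
  have hZ : (#(univ.filter fun x => κ₁ x = true) : ℤ) =
      1024 + 16 * (sZ b₁ * sZ b₂) * T * (1 - 4 * K) + 2 * sZ b₁ * (4 * k) + 128 * sZ b₁ * v₂ c₁ := by
    exact_mod_cast hc
  have hK01 : K = 0 ∨ K = 1 := by simp only [hKdef]; split_ifs <;> simp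
  have ho := Int.odd_iff.1 hk
  rcases tp_sZ_cases b₁ with h1 | h1 <;> rcases tp_sZ_cases b₂ with h2 | h2 <;> rcases hT1 with h3 | h3 <;>
    rcases hK01 with h4 | h4 <;> rw [h1, h2, h3, h4] at hZ <;> omega

/-- **Type-O branch lies above `1024`.**  Under the hypotheses of `topq_card_typeO_branch` with `κ₁` cubic: `1024 < #E₁`
(all cubic weights `≤ 1024`... below `1024` are `0, 512, 768, 896, 960, 992`, none `≡ 8 (mod 16)`, and `1024 ≢ 8`). [this work] -/
theorem topq_typeO_branch_gt (F₁ F₂ : (Fin (6 + 6) → Bool) → Bool) (u₁ u₂ v₁ v₂ : (Fin (6 + 6) → Bool) → ℤ)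
    (hu₁ : ∀ x, W (fun y => signOf (F₁ y)) x = (2 : ℝ) ^ 4 * (u₁ x : ℝ))
    (hu₂ : ∀ y, W (fun x => signOf (F₂ x)) y = (2 : ℝ) ^ 4 * (u₂ y : ℝ))
    (κ₁ κ₂ : (Fin (6 + 6) → Bool) → Bool) (hκ₁ : IsDegLeFun 3 κ₁) (b₁ b₂ : Bool) (c₁ c₂ : Fin (6 + 6) → Bool)
    (h₁ : ∀ x, (((u₁ x - 4 * sZ (F₂ x) : ℤ)) : ℝ) = signOf b₁ * twist c₁ x * (1 - 4 * (if κ₁ x = true then 1 else 0)) + 8 * (v₁ x : ℝ))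
    (h₂ : ∀ y, (((u₂ y - 4 * sZ (F₁ y) : ℤ)) : ℝ) = signOf b₂ * twist c₂ y * (1 - 4 * (if κ₂ y = true then 1 else 0)) + 8 * (v₂ y : ℝ))
    (k : ℤ) (hk : Odd k) (hkv : ∑ x, (v₁ x : ℝ) * twist x c₁ = 4 * (k : ℝ)) :
    1024 < #(univ.filter fun x => κ₁ x = true) := by
  have h8 := topq_card_typeO_branch F₁ F₂ u₁ u₂ v₁ v₂ hu₁ hu₂ κ₁ κ₂ b₁ b₂ c₁ c₂ h₁ h₂ k hk hkv
  by_contra hle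
  push Not at hle
  rcases Nat.lt_or_ge #(univ.filter fun x => κ₁ x = true) 1024 with hlt | hge
  · rcases kt3_weights_twelve κ₁ hκ₁ hlt with h | h | h | h | h | h <;> omega
  · omega

/-- **Level branch: `16 ∣ #E₁`.**  Setting of `topw_master`; if `8 ∣ v̂₁(c₁)` (`= 8k`) then `16 ∣ #E₁`. [this work] -/
theorem topq_card_level_branch (F₁ F₂ : (Fin (6 + 6) → Bool) → Bool) (u₁ u₂ v₁ v₂ : (Fin (6 + 6) → Bool) → ℤ)
    (hu₁ : ∀ x, W (fun y => signOf (F₁ y)) x = (2 : ℝ) ^ 4 * (u₁ x : ℝ))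
    (hu₂ : ∀ y, W (fun x => signOf (F₂ x)) y = (2 : ℝ) ^ 4 * (u₂ y : ℝ))
    (κ₁ κ₂ : (Fin (6 + 6) → Bool) → Bool) (b₁ b₂ : Bool) (c₁ c₂ : Fin (6 + 6) → Bool)
    (h₁ : ∀ x, (((u₁ x - 4 * sZ (F₂ x) : ℤ)) : ℝ) = signOf b₁ * twist c₁ x * (1 - 4 * (if κ₁ x = true then 1 else 0)) + 8 * (v₁ x : ℝ))
    (h₂ : ∀ y, (((u₂ y - 4 * sZ (F₁ y) : ℤ)) : ℝ) = signOf b₂ * twist c₂ y * (1 - 4 * (if κ₂ y = true then 1 else 0)) + 8 * (v₂ y : ℝ))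
    (k : ℤ) (hkv : ∑ x, (v₁ x : ℝ) * twist x c₁ = 8 * (k : ℝ)) :
    16 ∣ #(univ.filter fun x => κ₁ x = true) := by
  classical
  have hc := topw_card F₁ F₂ u₁ u₂ v₁ v₂ hu₁ hu₂ κ₁ κ₂ b₁ b₂ c₁ c₂ h₁ h₂
  rw [hkv] at hc
  obtain ⟨T, hT1, hT⟩ : ∃ T : ℤ, (T = 1 ∨ T = -1) ∧ twist c₂ c₁ = (T : ℝ) := by
    rcases Literature.Computability.QuantumComplexity.Simon.twist_eq_one_or c₂ c₁ with h | h
    · exact ⟨1, Or.inl rfl, by rw [h]; norm_num⟩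
    · exact ⟨-1, Or.inr rfl, by rw [h]; norm_num⟩
  set K : ℤ := if κ₂ c₁ = true then 1 else 0 with hKdef
  have hKR : (if κ₂ c₁ = true then (1 : ℝ) else 0) = (K : ℝ) := by simp only [hKdef]; split_ifs <;> simp
  rw [hT, hKR, ← tp_sZ_cast b₁, ← tp_sZ_cast b₂] at hc
  have hZ : (#(univ.filter fun x => κ₁ x = true) : ℤ) =
      1024 + 16 * (sZ b₁ * sZ b₂) * T * (1 - 4 * K) + 2 * sZ b₁ * (8 * k) + 128 * sZ b₁ * v₂ c₁ := by
    exact_mod_cast hc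
  have hK01 : K = 0 ∨ K = 1 := by simp only [hKdef]; split_ifs <;> simp
  have h16 : (16 : ℤ) ∣ (#(univ.filter fun x => κ₁ x = true) : ℤ) := by
    rcases tp_sZ_cases b₁ with h1 | h1 <;> rcases tp_sZ_cases b₂ with h2 | h2 <;> rcases hT1 with h3 | h3 <;>
      rcases hK01 with h4 | h4 <;> rw [h1, h2, h3, h4] at hZ <;> omega
  exact_mod_cast h16

end Summit.QuantumAdvantage.QuantumAdvantage.Theorems.CubicForrelation.NearExactIsExact

end
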